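import Mathlib
import HarnessLib
import Summits.HubbardSuperconductivity.HubbardSuperconductivity.Theorems.KLProgrammeKLRegimeEngineTwoLegStepSuccDoorProfile

/-!
# K3 ENGINE child `KLRegimeEngineV16` (stmt-HubbardSuperconductivity-20236): the DIVIDED-CONSTANT keying of stub 6 `stub_twoLeg_curvature`
# — the numeral table `klJetX`, the predicate `TwoLegCurveJetBoundX`, and the (e)-door keyed on it (J (R-i′), KL STATUS 2026-08-27T09:47:24Z)

Cell gate-hubbard-kl, seat hubbard-kl-r2d-p1 (g4).  The v4 skeleton of 20236 registers a sixth stub concluding p2 g10's `TwoLegCurveJetBound …`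
(…TwoLegCurvatureDefs, p517656) and inserts the same predicate as a hypothesis of (M) `stub_twoLeg_scale0` / (e) `stub_twoLeg_step`.  At the package's
own size fields (`TwoLegCurveJetBoundGQ`, bars `= twoLegBar G Q U k n`) that insert cannot be pushed through the chain-rule fit of p1b's profile closer
(numerals `4441 / 2.22·10⁶·(2π+1) / 1.776·10¹⁰`, `profileFit_of_curveJetBar_div`, …TwoLegStepSuccDoorProfile §3); with the constants DIVIDED by a
table `X` dominating those numerals it can, and the whole (E3a) conjunct of (e) is discharged (`twoLegStepV16_succ_of_curveJetsDiv_stub`).  J's render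
condition (R-i′) asks that such a table be a LANDED importable def.  This file lands ONE such table and the keyed objects (a PROPOSAL for the
registrant's/pen's keying — any landed table dominating the three numerals serves; orders `k ≥ 3` are NOT divided here: no (e)/(M) consumer reads them
through a fit, the MS lane says if it needs a quotient there):

* §1 `klJetX : ℕ → ℝ` — `4441, 2.6·10¹¹, 3.6·10¹⁰, 1, 1, …`; `klJetX_pos`, `one_le_klJetX`, the three defining values;
* §2 `TwoLegCurveJetBoundX L M G Q β U μ K n := TwoLegCurveJetBound L M (G.S/klJetX) (Q.S'/klJetX) β U μ K n` (explicit def, no instance/notation),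
  `twoLegCurveJetBoundX_iff`, and **`TwoLegCurveJetBoundX.toGQ`**: the divided bound IMPLIES the package-keyed one `TwoLegCurveJetBoundGQ` (bars only shrink,
  `klJetX ≥ 1`) — so a GQ consumer loses nothing under the divided keying;
* §3 **`twoLegStepV16_succ_of_curveJetsX_stub`** — under (e)'s literal binders at `n + 1`: `TwoLegStepV16 … (n+1)` from
  `TwoLegCurveJetBoundX L M klEngGeo5 (klEngQ5 P R) β U μ K (n+1)` + the (E3c)/(E3e) rows + (B) by name + (C) the nested legs, NO numeral hypothesis left.

Definitions with bodies + proofs; nothing about the model is asserted.  References: BGM 2006 §2.4 (2.36) [cite: BenfattoGiulianiMastropietro2006];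
KL STATUS l.2448 / l.2466 ((R-i′)) / l.2470.
-/

noncomputable section

namespace Summit.HubbardSuperconductivity.HubbardSuperconductivity.Theorems.KLRegimeSplit

set_option linter.dupNamespace false -- summit = problem name (single-conjunct summit), D-0017

open Real Literature.MathematicalPhysics.QuantumLattice Literature.Probability.LatticeModels

/-! ## §1 The numeral table -/

/-- **`klJetX k`** — the chain-rule losses of the two-leg consumers by jet order: `4441` (order 0), `2.6·10¹¹` (order 1; it re-enters the order-2 fit),
`3.6·10¹⁰` (order 2); orders `≥ 3` undivided (`1`). [cell bookkeeping] -/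
def klJetX (k : ℕ) : ℝ :=
  if k = 0 then 4441 else if k = 1 then 2.6e11 else if k = 2 then 3.6e10 else 1

/-- `klJetX 0 = 4441`. -/
@[simp] theorem klJetX_zero : klJetX 0 = 4441 := by simp [klJetX]
/-- `klJetX 1 = 2.6·10¹¹`. -/
@[simp] theorem klJetX_one : klJetX 1 = 2.6e11 := by simp [klJetX]
/-- `klJetX 2 = 3.6·10¹⁰`. -/
@[simp] theorem klJetX_two : klJetX 2 = 3.6e10 := by simp [klJetX]
/-- `klJetX k = 1` for `k ≥ 3`. -/
theorem klJetX_of_three_le {k : ℕ} (hk : 3 ≤ k) : klJetX k = 1 := by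
  unfold klJetX
  rw [if_neg (by omega), if_neg (by omega), if_neg (by omega)]

/-- `1 ≤ klJetX k`. -/
theorem one_le_klJetX (k : ℕ) : 1 ≤ klJetX k := by
  unfold klJetX; split_ifs <;> norm_num

/-- `0 < klJetX k`. -/
theorem klJetX_pos (k : ℕ) : 0 < klJetX k := lt_of_lt_of_le one_pos (one_le_klJetX k)

/-! ## §2 The divided-constant predicate and its comparison with the package-keyed one -/

section Model

variable (L M : ℕ) [NeZero L] [NeZero M]

/-- **`TwoLegCurveJetBoundX L M G Q β U μ K n`** — the per-scale angular-jet bound of the two-leg profile (p2's `TwoLegCurveJetBound`) with the package's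
size fields DIVIDED by `klJetX`: bars `twoLegBar G Q U k n / klJetX k`. [cell bookkeeping] -/
def TwoLegCurveJetBoundX (G : GeoConsts) (Q : EngConsts) (β U μ : ℝ) (K : TrigPolyC4v) (n : ℕ) : Prop :=
  TwoLegCurveJetBound L M (fun k => G.S k / klJetX k) (fun k => Q.S' k / klJetX k) β U μ K n

end Model

variable {L M : ℕ} [NeZero L] [NeZero M]

/-- Unfolding `TwoLegCurveJetBoundX`. -/
theorem twoLegCurveJetBoundX_iff (G : GeoConsts) (Q : EngConsts) (β U μ : ℝ) (K : TrigPolyC4v) (n : ℕ) :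
    TwoLegCurveJetBoundX L M G Q β U μ K n ↔
      TwoLegCurveJetBound L M (fun k => G.S k / klJetX k) (fun k => Q.S' k / klJetX k) β U μ K n :=
  Iff.rfl

/-- **The divided bound implies the package-keyed bound** (`TwoLegCurveJetBoundGQ`): dividing nonnegative size fields by `klJetX ≥ 1` only shrinks
the bars — a consumer keyed on the GQ form loses nothing under the divided keying. -/
theorem TwoLegCurveJetBoundX.toGQ {G : GeoConsts} {Q : EngConsts} (hS : ∀ k, 0 ≤ G.S k) (hS' : ∀ k, 0 ≤ Q.S' k) {β U μ : ℝ}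
    {K : TrigPolyC4v} {n : ℕ} (h : TwoLegCurveJetBoundX L M G Q β U μ K n) : TwoLegCurveJetBoundGQ L M G Q β U μ K n :=
  TwoLegCurveJetBound.mono (fun k => div_le_self (hS k) (one_le_klJetX k)) (fun k => div_le_self (hS' k) (one_le_klJetX k)) h

end Summit.HubbardSuperconductivity.HubbardSuperconductivity.Theorems.KLRegimeSplit

namespace Summit.HubbardSuperconductivity.HubbardSuperconductivity.Theorems.EngineV8

set_option linter.dupNamespace false -- summit = problem name (single-conjunct summit), D-0017

open Real Finset Literature.MathematicalPhysics.QuantumLattice Literature.Probability.LatticeModels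
open Literature.MathematicalPhysics.QuantumLattice.FermiRG Literature.MathematicalPhysics.QuantumLattice.BandSectorCounting
open Summit.HubbardSuperconductivity.HubbardSuperconductivity.Theorems.KLProgrammeLegKernels
open Summit.HubbardSuperconductivity.HubbardSuperconductivity.Theorems.DispersionFlow
open Summit.HubbardSuperconductivity.HubbardSuperconductivity.Theorems.PerturbedFermiCurve
open Summit.HubbardSuperconductivity.HubbardSuperconductivity.Theorems.KLRegimeSplit

/-! ## §3 The (e)-door at `n + 1` keyed on `TwoLegCurveJetBoundX` at the engine's package — (E3a) discharged, no numeral hypothesis left -/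

/-- **THE (e)-DOOR AT `n + 1` KEYED ON THE DIVIDED STUB-6 PREDICATE AT THE ENGINE'S PACKAGE.**  Under (e)'s literal binders,
`TwoLegStepV16 L M klEngGeo5 P (klEngQ5 P R) R β U μ K (n+1)` from `hJ : TwoLegCurveJetBoundX L M klEngGeo5 (klEngQ5 P R) β U μ K (n+1)` (what a
v4 skeleton keyed this way feeds stub (e) from `stub_twoLeg_curvature`), the (E3c) rows (`hd/hnear/hvK'/hfitL/hfar`), the (E3e) rows (`hz/hm₁'/hfit1`),
(B) `TwoLegSizesMSTQ … (n+1)` by name and (C) the two nested-leg rates (`twoLegStepV16_succ_of_curveJetsDiv_stub` at `X := klJetX`). -/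
theorem twoLegStepV16_succ_of_curveJetsX_stub (P : SplitConsts) (R : RenConsts) (c : ℝ) (hP : P.WF) (hR : R.WF2) (hc : 0 < c)
    (hc3 : c ≤ klEngC₃3 P R) (μ : ℝ) (hμ : μ ∈ klWindowC) (U : ℝ) (hU : 0 < U) (hUle : U ≤ klEngU₀4 P R c) (β : ℝ) (hβ : klBetaMin ≤ β)
    (hβc : β ≤ Real.exp (c / U ^ 2)) (K : TrigPolyC4v) (hK : FrameOKDeg R U (nScales β) μ K) (L M : ℕ) [NeZero L] [NeZero M]
    (hL : klEngL₃ β U ≤ L) (hM : klEngM₃ β U L ≤ M) (n : ℕ) (hn : n + 1 ≤ nScales β + 1) (hreg : IsKLRegime U c (-((n + 1 : ℕ) : ℤ)))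
    (hhist : HistP klPredsV16 L M klEngGeo5 P (klEngQ5 P R) R β U μ K (n + 1))
    (hE : EngineBoundsAtV10S L M klEngGeo5 P (klEngQ5 P R) β U μ K (n + 1))
    -- (A) stub 6's conclusion at scale `n + 1` in the divided keying
    (hJ : TwoLegCurveJetBoundX L M klEngGeo5 (klEngQ5 P R) β U μ K (n + 1))
    {d ρ : ℝ} (hd : 0 < d)
    (hnear : ∀ K' : TrigPolyC4v, FrameOKDeg R U (klTempScaleIdx β klE0) μ K' →
      (∀ j < n + 1, histV15 L M klEngGeo5 P (klEngQ5 P R) R β U μ K' j) → frameDist K K' ≤ d → ∀ θ : ℝ,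
      |(klLocalPart L M β U μ K (n + 1) θ - klLocalPart L M β U μ K n θ) -
        (klLocalPart L M β U μ K' (n + 1) θ - klLocalPart L M β U μ K' n θ)| ≤ ρ * frameDist K K')
    (hvK' : ∀ K' : TrigPolyC4v, FrameOKDeg R U (klTempScaleIdx β klE0) μ K' →
      (∀ j < n + 1, histV15 L M klEngGeo5 P (klEngQ5 P R) R β U μ K' j) → ∀ θ : ℝ,
      |klLocalPart L M β U μ K' (n + 1) θ - klLocalPart L M β U μ K' n θ| ≤ curveJetBar (fun k => klEngGeo5.S k / klJetX k) (fun k => (klEngQ5 P R).S' k / klJetX k) U 0 (n + 1))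
    (hfitL : ρ ≤ lipBar klEngGeo5 (klEngQ5 P R) U (n + 1)) (hfar : 2 * curveJetBar (fun k => klEngGeo5.S k / klJetX k) (fun k => (klEngQ5 P R).S' k / klJetX k) U 0 (n + 1) ≤ lipBar klEngGeo5 (klEngQ5 P R) U (n + 1) * d)
    (hz : ∀ k ∈ klShell L μ K (n + 1), |klFieldStrength L M β U μ K (n + 1) k - 1| ≤ R.cz * |U|)
    {m₁' : ℝ}
    (hm₁' : ∀ q : Momentum, |frameLevel μ K q| ≤ klScale klE0 (n + 1) →
      ‖fderiv ℝ (evalM (symInterp L (fun p => klLocSelfEnergyRe L M β U μ K (n + 1) p - K.eval (latticeMomentum L p)))) q‖ ≤ m₁')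
    (hfit1 : m₁' + 4 / 3 * R.Gfr 1 * U ^ 2 ≤ R.cz * |U| * (cDtmin (-1.2) (-0.05) / 2))
    -- (B) the multi-slot sizes at scale `n + 1`, by name (opened in `…TwoLegStepSuccDoorMS`)
    (hms : TwoLegSizesMSTQ L M klEngGeo5 (klEngQ5 P R) R β U μ K (n + 1))

    -- (C) the two nested-leg rates at scale `n + 1`
    (hcut : ∀ (Mq : ℕ → ℕ) (L₁ M₁ M₂ : ℕ) [NeZero L₁] [NeZero M₁] [NeZero M₂], L ≤ L₁ → (klEngQ5 P R).M0 β L₁ ≤ M₁ → Mq L₁ ≤ M₁ → M₁ ≤ M₂ →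
      (∀ j < n + 1, histV15 L₁ M₁ klEngGeo5 P (klEngQ5 P R) R β U μ K j ∧
        TwoLegCoreTD L₁ M₁ (histV15 L₁ M₁ klEngGeo5 P (klEngQ5 P R) R β U μ) klEngGeo5 P (klEngQ5 P R) R β U μ K j ∧
          TwoLegSizesMSTQ L₁ M₁ klEngGeo5 (klEngQ5 P R) R β U μ K j) →
      (∀ j < n + 1, histV15 L₁ M₂ klEngGeo5 P (klEngQ5 P R) R β U μ K j ∧
        TwoLegCoreTD L₁ M₂ (histV15 L₁ M₂ klEngGeo5 P (klEngQ5 P R) R β U μ) klEngGeo5 P (klEngQ5 P R) R β U μ K j ∧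
          TwoLegSizesMSTQ L₁ M₂ klEngGeo5 (klEngQ5 P R) R β U μ K j) →
        ∀ θ : ℝ, |klLocalPart L₁ M₁ β U μ K (n + 1) θ - klLocalPart L₁ M₂ β U μ K (n + 1) θ| ≤ (klEngQ5 P R).CL β (n + 1) / 4 / L₁)
    (hsp : ∀ (Mq : ℕ → ℕ) (L₁ L₂ M₂ : ℕ) [NeZero L₁] [NeZero L₂] [NeZero M₂], L ≤ L₁ → L₁ ∣ L₂ → (klEngQ5 P R).M0 β L₁ ≤ M₂ → Mq L₁ ≤ M₂ →
      (klEngQ5 P R).M0 β L₂ ≤ M₂ → Mq L₂ ≤ M₂ →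
      (∀ j < n + 1, histV15 L₁ M₂ klEngGeo5 P (klEngQ5 P R) R β U μ K j ∧
        TwoLegCoreTD L₁ M₂ (histV15 L₁ M₂ klEngGeo5 P (klEngQ5 P R) R β U μ) klEngGeo5 P (klEngQ5 P R) R β U μ K j ∧
          TwoLegSizesMSTQ L₁ M₂ klEngGeo5 (klEngQ5 P R) R β U μ K j) →
      (∀ j < n + 1, histV15 L₂ M₂ klEngGeo5 P (klEngQ5 P R) R β U μ K j ∧
        TwoLegCoreTD L₂ M₂ (histV15 L₂ M₂ klEngGeo5 P (klEngQ5 P R) R β U μ) klEngGeo5 P (klEngQ5 P R) R β U μ K j ∧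
          TwoLegSizesMSTQ L₂ M₂ klEngGeo5 (klEngQ5 P R) R β U μ K j) →
        ∀ θ : ℝ, |klLocalPart L₁ M₂ β U μ K (n + 1) θ - klLocalPart L₂ M₂ β U μ K (n + 1) θ| ≤ (klEngQ5 P R).CL β (n + 1) / 4 / L₁) :
    TwoLegStepV16 L M klEngGeo5 P (klEngQ5 P R) R β U μ K (n + 1) :=
  twoLegStepV16_succ_of_curveJetsDiv_stub P R c hP hR hc hc3 μ hμ U hU hUle β hβ hβc K hK L M hL hM n hn hreg hhist hE
    (X := klJetX) (by rw [klJetX_zero]) (by rw [klJetX_one]) (by rw [klJetX_two])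
    ((twoLegCurveJetBoundX_iff klEngGeo5 (klEngQ5 P R) β U μ K (n + 1)).1 hJ) hd hnear hvK' hfitL hfar hz hm₁' hfit1 hms hcut hsp

end Summit.HubbardSuperconductivity.HubbardSuperconductivity.Theorems.EngineV8

end
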